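import Summits.BirchSwinnertonDyer.BirchSwinnertonDyer.Theorems.ByReductionTypeAtTwoAdditivePotGoodLowerHalfT0DyadicNonNormDescent
import Summits.BirchSwinnertonDyer.BirchSwinnertonDyer.Theorems.ByReductionTypeAtTwoFineSelmerConjAAtTwoAdditivePotGoodChevalleyOneBitDoor
import Mathlib.NumberTheory.NumberField.ClassNumber
import HarnessLib

/-!
# K4 crux `AdditiveRankZeroAtTwo` (19098), children C3″ (22617) / C1″ (22615): the LAYER-TWO NON-NORM UNIT of the narrow rank certificate, GENERIC —
# from the layer-one dyadic data of a cubic point field (k4-w1's `layer_one_dyadic_d<D>` / `layer_one_ids_d<D>`: the prime `ξ` of `A₁` above the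
# degree-one dyadic prime, `2 = ξ²w₁`, `2 + s = ξμ`) and ONE cubic unit `ε₀ ≡ 5 (mod ξ⁶)`, a unit of `A₂ = A₁(t)`, `t² = 2 + s`, that is NOT a norm
# from `A₃ = A₂(√(2 + t))`, provided `h(A₂)` is odd (KERNEL; the `e = 4` dyadic obstruction at the prime of `A₂` above `ξ`)
# (seat `bsd-2adic-k4-w2` GEN 15; `--supports stmt-BirchSwinnertonDyer-22617 --as helper`)

Cell `bsd-2adic`.  THEOREMS ONLY (no definition, no named fact, no `sorry`).  MODEL-FREE: `F ⊆ E` any number fields with `[E : F] = 2`, data in `𝓞 F`: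
a prime element `ξ` with residues `{0,1}`, `ξ²·w₁ = 2`, `w₁ ≡ 1 (mod ξ)`, `ξ·μ = 2 + s_F`, `μ ≡ 1 (mod ξ)`, `s_F² = 2`; a unit `ε₀` with `ε₀ − 5 = ξ⁶·c₆`;
`h(E)` odd; `t ∈ E` with `t² = 2 + s_F`.  THE ARGUMENT: the ideal `𝔔 = (ξ, t)` of `𝓞 E` has `𝔔² = (ξ)` (`t² = ξμ`, `ξ = t² − ξ²z_μ`), so its class
has order `≤ 2`, hence `1` (odd class number): `𝔔 = (π)`; `N(𝔔)² = |N ξ| ^ [E:F] = 4`, so `N(𝔔) = 2`: `π` is a prime element with residues `{0,1}`;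
`ξ = π²v`, `2 = π⁴·W` (`W = v²w₁`, `π ∤ W`), `t = π·μ_t` (`t⁴ = 4t² − 2`), `2 + t = π·M` (`π ∤ M`), and `ε₀ − 1 = 4 + ξ⁶c₆ = π⁸(W² + π⁴v⁶c₆)` has
`π`-order EXACTLY `8 = 2e`.  GEN 15's dyadic descent (`DyadicDescent.not_exists_sq_sub_mul_sq_fractionRing_of_pow_two_mul_dvd`, `e = 4`) then forbids
`x² − (2 + t)y² = ε₀` — `(ε₀, 2 + t)_𝔔 = −1`, the `u ≡ ±3 (mod 8)` obstruction of the cubic unit read two layers up.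

* §1 `absNorm_span_singleton_eq_two_of_residues` — a prime element with residues `{0,1}` generates an ideal of norm `2`.
* §2 ★ `exists_unit_forall_sq_sub_mul_sq_ne_of_layerOneData` — the theorem above: `∃ η : (𝓞 E)ˣ, ∀ a c : E, a² − (2 + t)·c² ≠ η` (`η = ε₀`).
  Consumer: GEN 15's parity step at `m = 2` (`h(A₂)` odd + this ⟹ `h(A₃)` odd), discharging the displayed `hL` of the rung-`m = 2` stamps.

HONEST FRAMING (D-0036 / D-0054 / D-0152): a theorem about number fields; nothing is asserted about any curve; closes nothing at the `∀`-level; nothing booked;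
BSD is not proved by any of this.

References: [Omeara1963] §63A (63:1, 63:3), §63B (63:10); [Lang1990] Ch. 13 §4; [Marcus1977] Ch. 3 Thm. 22 (`‖(α)‖ = |N(α)|`), Ch. 2 Thm. 4;
[Washington1997] §13.1; [NeukirchANT1999] Ch. I §3, Ch. V §3.
-/

set_option autoImplicit false
-- sibling precedent (`…DyadicNonNormDescent.lean`): the directory name repeats the summit name
set_option linter.dupNamespace false

noncomputable section

open scoped Classical NumberField nonZeroDivisors

namespace Summit.BirchSwinnertonDyer.BirchSwinnertonDyer.Theorems.AddKatoTwo

open Polynomial IsDedekindDomain NumberField Ideal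

/-! ## §1 Norm `2` from residues `{0,1}` -/

section Norm

variable {F : Type} [Field F] [NumberField F]

/-- **A prime element `ξ` of `𝓞 F` with residues `{0, 1}` generates an ideal of absolute norm `2`** (`𝓞 F/(ξ) = {0̄, 1̄}`, `0̄ ≠ 1̄`).
[cite: Marcus1977, Ch. 3 Thm. 22 (c)] -/
theorem absNorm_span_singleton_eq_two_of_residues {ξ : 𝓞 F} (hprime : Prime ξ) (hres : ∀ z : 𝓞 F, ξ ∣ z ∨ ξ ∣ z - 1) :
    Ideal.absNorm (Ideal.span {ξ}) = 2 := by
  rw [Ideal.absNorm_apply, Submodule.cardQuot_apply]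
  rw [Nat.card_eq_two_iff]
  refine ⟨Ideal.Quotient.mk _ 0, Ideal.Quotient.mk _ 1, ?_, ?_⟩
  · intro h
    rw [Ideal.Quotient.eq, Ideal.mem_span_singleton] at h
    have h1 : ξ ∣ (1 : 𝓞 F) := by
      have : ξ ∣ -((0 : 𝓞 F) - 1) := (dvd_neg).mpr h
      simpa using this
    exact hprime.not_unit (isUnit_of_dvd_one h1)
  · rw [Set.eq_univ_iff_forall]
    intro z
    obtain ⟨z, rfl⟩ := Ideal.Quotient.mk_surjective z
    rcases hres z with h | h
    · left
      rw [Ideal.Quotient.eq, Ideal.mem_span_singleton]; simpa using h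
    · right; rw [Set.mem_singleton_iff, Ideal.Quotient.eq, Ideal.mem_span_singleton]; exact h

variable {E : Type} [Field E] [NumberField E] [Algebra F E]

/-- In a quadratic extension `E/F`, `|N_{E/ℚ}(x)| = |N_{F/ℚ}(x)|²` for `x ∈ 𝓞 F` (norm transitivity). [cite: Marcus1977, Ch. 2 Thm. 4] -/
private theorem natAbs_norm_algebraMap_sq_lt (h2 : Module.finrank F E = 2) (x : 𝓞 F) :
    (Algebra.norm ℤ (algebraMap (𝓞 F) (𝓞 E) x)).natAbs = (Algebra.norm ℤ x).natAbs ^ 2 := by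
  haveI : IsScalarTower ℚ F E := IsScalarTower.of_algebraMap_eq fun q => by simp only [eq_ratCast, map_ratCast]
  haveI : Module.Free F E := Module.Free.of_divisionRing _ _
  have hval : ((algebraMap (𝓞 F) (𝓞 E) x : 𝓞 E) : E) = algebraMap F E (x : F) :=
    (IsScalarTower.algebraMap_apply (𝓞 F) (𝓞 E) E x).symm.trans (IsScalarTower.algebraMap_apply (𝓞 F) F E x)
  have h1 : (Algebra.norm ℤ (algebraMap (𝓞 F) (𝓞 E) x) : ℚ) = ((Algebra.norm ℤ x) ^ 2 : ℤ) := by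
    rw [Algebra.coe_norm_int, hval, ← Algebra.norm_norm (R := ℚ) (S := F) (a := algebraMap F E (x : F)),
      Algebra.norm_algebraMap, h2, map_pow, ← Algebra.coe_norm_int]
    push_cast; ring
  have h4 : Algebra.norm ℤ (algebraMap (𝓞 F) (𝓞 E) x) = (Algebra.norm ℤ x) ^ 2 := by exact_mod_cast h1
  rw [h4, Int.natAbs_pow]

end Norm

/-! ## §2 The layer-two non-norm unit -/

section LayerTwo

set_option maxHeartbeats 3200000 in
/-- ★ **The layer-two non-norm unit from layer-one data.**  `F ⊆ E` number fields, `[E : F] = 2`; in `𝓞 F`: a prime element `ξ` with residues `{0,1}`,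
`ξ²·w₁ = 2` with `w₁ − 1 = ξ·z_w`, `ξ·μ = 2 + s_F` with `μ − 1 = ξ·z_μ`, `s_F² = 2`, and a unit `ε₀` (`ε₀·ε₀' = 1`) with `ε₀ − 5 = ξ⁶·c₆`; `h(E)` odd;
`t ∈ E` with `t² = 2 + s_F`.  Then `a² − (2 + t)·c² ≠ ε₀` for all `a, c ∈ E` — `ε₀` is not a norm from `E(√(2+t))`.  (`𝔔 = (ξ, t)`, `𝔔² = (ξ)`,
`h(E)` odd ⟹ `𝔔 = (π)`, `N(𝔔) = 2`; `2 = π⁴W`, `2 + t = πM`, `π⁸ ‖ ε₀ − 1`; dyadic descent at `e = 4`.)  KERNEL, model-free.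
[cite: Omeara1963, §63B (63:10) and §63A (63:1, 63:3)] [cite: Lang1990, Ch. 13 §4] [cite: Marcus1977, Ch. 3 Thm. 22] -/
theorem exists_unit_forall_sq_sub_mul_sq_ne_of_layerOneData
    (F E : Type) [Field F] [NumberField F] [Field E] [NumberField E] [Algebra F E]
    (h2 : Module.finrank F E = 2)
    {ξ w₁ zw μ zμ sF ε₀ ε₀' c₆ : 𝓞 F}
    (hprime : Prime ξ) (hres : ∀ z : 𝓞 F, ξ ∣ z ∨ ξ ∣ z - 1)
    (htwo : ξ ^ 2 * w₁ = 2) (hwz : w₁ - 1 = ξ * zw)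
    (hximu : ξ * μ = 2 + sF) (hmuz : μ - 1 = ξ * zμ) (hsF : sF ^ 2 = 2)
    (hεinv : ε₀ * ε₀' = 1) (hc6 : ε₀ - 5 = ξ ^ 6 * c₆)
    (hodd : Odd (classNumber E))
    (t : E) (ht : t ^ 2 = algebraMap (𝓞 F) E (2 + sF)) :
    ∃ η : (𝓞 E)ˣ, ∀ a c : E, a ^ 2 - (2 + t) * c ^ 2 ≠ ((η : 𝓞 E) : E) := by
  haveI : IsScalarTower ℚ F E := IsScalarTower.of_algebraMap_eq fun q => by simp only [eq_ratCast, map_ratCast]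
  obtain ⟨φ, hφ⟩ : ∃ φ : 𝓞 F →+* 𝓞 E, φ = algebraMap (𝓞 F) (𝓞 E) := ⟨_, rfl⟩
  have hφE : ∀ x : 𝓞 F, ((φ x : 𝓞 E) : E) = algebraMap (𝓞 F) E x := fun x => by
    rw [hφ]; exact (IsScalarTower.algebraMap_apply (𝓞 F) (𝓞 E) E x).symm
  -- the integer `t`
  have htint : IsIntegral ℤ t := by
    refine IsIntegral.of_pow two_pos ?_
    rw [ht, ← hφE]
    exact NumberField.RingOfIntegers.isIntegral_coe _
  set tE : 𝓞 E := ⟨t, htint⟩ with htEdef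
  have htEval : algebraMap (𝓞 E) E tE = t := rfl
  have hcoe : ∀ y : 𝓞 E, ((y : 𝓞 E) : E) = algebraMap (𝓞 E) E y := fun y => NumberField.RingOfIntegers.coe_eq_algebraMap y
  have htE2 : tE ^ 2 = φ (2 + sF) := by
    apply NumberField.RingOfIntegers.coe_injective
    rw [map_pow, htEval, ht, ← hφE, hcoe]
  -- images of the data in `𝓞 E`
  have htwoE : φ ξ ^ 2 * φ w₁ = 2 := by rw [← map_pow, ← map_mul, htwo, map_ofNat]
  have hwzE : φ w₁ - 1 = φ ξ * φ zw := by rw [← map_mul, ← hwz, map_sub, map_one]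
  have hximuE : φ ξ * φ μ = tE ^ 2 := by rw [← map_mul, hximu, htE2]
  have hmuzE : φ μ - 1 = φ ξ * φ zμ := by rw [← map_mul, ← hmuz, map_sub, map_one]
  have htE4 : tE ^ 4 = 4 * tE ^ 2 - 2 := by
    have h1 : tE ^ 4 = φ ((2 + sF) ^ 2) := by rw [map_pow, ← htE2]; ring
    rw [h1, htE2]
    have h3 : (2 + sF) ^ 2 = 4 * (2 + sF) - 2 := by linear_combination hsF
    rw [h3, map_sub, map_mul, map_ofNat, map_ofNat]
  have hεE : φ ε₀ * φ ε₀' = 1 := by rw [← map_mul, hεinv, map_one]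
  have hc6E : φ ε₀ - 5 = φ ξ ^ 6 * φ c₆ := by
    have := congrArg φ hc6
    rwa [map_sub, map_ofNat, map_mul, map_pow] at this
  have hξ0 : φ ξ ≠ 0 := by
    intro h0
    have : (2 : 𝓞 E) = 0 := by rw [← htwoE, h0]; ring
    exact two_ne_zero this
  -- the ideal `𝔔 = (ξ, t)` and `𝔔² = (ξ)`
  set Q : Ideal (𝓞 E) := Ideal.span {φ ξ, tE} with hQdef
  have hQ2 : Q ^ 2 = Ideal.span {φ ξ} := by
    rw [sq, hQdef, Ideal.span_pair_mul_span_pair]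
    apply le_antisymm
    · rw [Ideal.span_le]
      intro z hz
      simp only [Set.mem_insert_iff, Set.mem_singleton_iff] at hz
      rw [SetLike.mem_coe, Ideal.mem_span_singleton]
      rcases hz with rfl | rfl | rfl | rfl
      · exact Dvd.intro _ rfl
      · exact Dvd.intro _ rfl
      · exact Dvd.intro_left _ rfl
      · rw [← sq, ← hximuE]; exact Dvd.intro _ rfl
    · rw [Ideal.span_singleton_le_iff_mem]
      -- `ξ = t² − ξ² z_μ`
      have hx : φ ξ = tE * tE - φ zμ * (φ ξ * φ ξ) := by
        linear_combination (-(φ ξ)) * hmuzE + hximuE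
      have hmem : tE * tE - φ zμ * (φ ξ * φ ξ) ∈
          Ideal.span ({φ ξ * φ ξ, φ ξ * tE, tE * φ ξ, tE * tE} : Set (𝓞 E)) :=
        Ideal.sub_mem _ (Ideal.subset_span (Set.mem_insert_of_mem _ (Set.mem_insert_of_mem _
            (Set.mem_insert_of_mem _ (Set.mem_singleton _)))))
          (Ideal.mul_mem_left _ _ (Ideal.subset_span (Set.mem_insert _ _)))
      rw [← hx] at hmem
      exact hmem
  -- `𝔔` is principal: its class has order dividing `2` and the class number is odd
  have hQ0 : Q ≠ ⊥ := by
    intro h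
    have : φ ξ ∈ Q := Ideal.subset_span (by simp)
    rw [h, Ideal.mem_bot] at this
    exact hξ0 this
  have hQmem : Q ∈ (Ideal (𝓞 E))⁰ := mem_nonZeroDivisors_of_ne_zero hQ0
  have hspanne : Ideal.span {φ ξ} ≠ ⊥ := by rw [Ne, Ideal.span_singleton_eq_bot]; exact hξ0
  have hspan0 : Ideal.span {φ ξ} ∈ (Ideal (𝓞 E))⁰ := mem_nonZeroDivisors_of_ne_zero hspanne
  have hg2 : ClassGroup.mk0 ⟨Q, hQmem⟩ ^ 2 = 1 := by
    have h1 : (⟨Q, hQmem⟩ : (Ideal (𝓞 E))⁰) ^ 2 = ⟨Ideal.span {φ ξ}, hspan0⟩ := by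
      apply Subtype.ext; rw [SubmonoidClass.coe_pow]; exact hQ2
    rw [← map_pow, h1]
    exact (ClassGroup.mk0_eq_one_iff hspan0).mpr ⟨⟨φ ξ, by rw [Ideal.submodule_span_eq]⟩⟩
  have hg1 : ClassGroup.mk0 ⟨Q, hQmem⟩ = 1 := by
    have hord : orderOf (ClassGroup.mk0 ⟨Q, hQmem⟩) ∣ 2 := orderOf_dvd_of_pow_eq_one hg2
    have hcard : orderOf (ClassGroup.mk0 ⟨Q, hQmem⟩) ∣ classNumber E := by
      rw [classNumber]; exact orderOf_dvd_card
    have h21 : orderOf (ClassGroup.mk0 ⟨Q, hQmem⟩) = 1 := by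
      rcases (Nat.dvd_prime Nat.prime_two).mp hord with h | h
      · exact h
      · exfalso
        rw [h] at hcard
        exact (Nat.not_even_iff_odd.mpr hodd) (even_iff_two_dvd.mpr hcard)
    exact orderOf_eq_one_iff.mp h21
  haveI hprinc : Submodule.IsPrincipal Q := (ClassGroup.mk0_eq_one_iff hQmem).mp hg1
  obtain ⟨π, hπgen⟩ := Submodule.IsPrincipal.principal Q
  have hQπ : Q = Ideal.span {π} := by rw [hπgen, Ideal.submodule_span_eq]
  -- `N(𝔔) = 2`: `π` is a prime element with residues `{0,1}`
  have hNξ : Ideal.absNorm (Ideal.span {φ ξ}) = 4 := by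
    rw [Ideal.absNorm_span_singleton, hφ, natAbs_norm_algebraMap_sq_lt h2, ← Ideal.absNorm_span_singleton,
      absNorm_span_singleton_eq_two_of_residues hprime hres]
    norm_num
  have hNQ : Ideal.absNorm Q = 2 := by
    have h1 : Ideal.absNorm Q ^ 2 = 2 ^ 2 := by rw [← map_pow, hQ2, hNξ]; norm_num
    exact Nat.pow_left_injective two_ne_zero h1
  have hQprime : Q.IsPrime := Ideal.isPrime_of_irreducible_absNorm (by rw [hNQ]; exact Nat.prime_two)
  have hπ0 : π ≠ 0 := by
    intro h; apply hQ0; rw [hQπ, h, Ideal.span_singleton_eq_bot]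
  have hπ : Prime π := (Ideal.span_singleton_prime hπ0).mp (hQπ ▸ hQprime)
  have hresπ : ∀ z : 𝓞 E, π ∣ z ∨ π ∣ z - 1 := by
    intro z
    rcases mem_or_sub_one_mem_of_absNorm_eq_two E Q hNQ z with h | h
    · left; rw [hQπ, Ideal.mem_span_singleton] at h; exact h
    · right; rw [hQπ, Ideal.mem_span_singleton] at h; exact h
  have hone : ∀ {y z : 𝓞 E}, y - 1 = π * z → ¬ π ∣ y := by
    rintro y z hyz ⟨c, hc⟩
    exact hπ.not_unit (isUnit_of_dvd_one ⟨c - z, by linear_combination hc - hyz⟩)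
  -- `ξ = π² v`
  have hassoc : Associated (π ^ 2) (φ ξ) := by
    rw [← Ideal.span_singleton_eq_span_singleton, ← Ideal.span_singleton_pow, ← hQπ, hQ2]
  obtain ⟨v, hv⟩ := hassoc
  -- `2 = π⁴ W`, `π ∤ W`
  obtain ⟨W, hWdef⟩ : ∃ W : 𝓞 E, W = (v : 𝓞 E) ^ 2 * φ w₁ := ⟨_, rfl⟩
  have h2W : (2 : 𝓞 E) = π ^ 4 * W := by
    linear_combination (-1 : 𝓞 E) * htwoE - (φ w₁ * (φ ξ + π ^ 2 * (v : 𝓞 E))) * hv - π ^ 4 * hWdef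
  have hvndvd : ¬ π ∣ (v : 𝓞 E) := fun h => hπ.not_unit (isUnit_of_dvd_unit h v.isUnit)
  have hw₁ndvd : ¬ π ∣ φ w₁ := by
    refine hone (z := π * (v : 𝓞 E) * φ zw) ?_
    linear_combination hwzE - (φ zw) * hv
  have hW : ¬ π ∣ W := by
    intro h
    rw [hWdef] at h
    rcases hπ.dvd_or_dvd h with h1 | h1
    · exact hvndvd (hπ.dvd_of_dvd_pow h1)
    · exact hw₁ndvd h1
  -- `t = π μ_t`, `π ∤ μ_t`
  have hπt : π ∣ tE := by
    apply hπ.dvd_of_dvd_pow (n := 4)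
    exact ⟨π ^ 3 * W * (2 * tE ^ 2 - 1), by rw [htE4]; linear_combination (2 * tE ^ 2 - 1) * h2W⟩
  obtain ⟨μt, hμt⟩ := hπt
  have hμt4 : μt ^ 4 = W * (2 * tE ^ 2 - 1) := by
    have h1 : π ^ 4 * μt ^ 4 = π ^ 4 * (W * (2 * tE ^ 2 - 1)) := by
      have : tE ^ 4 = 2 * (2 * tE ^ 2 - 1) := by rw [htE4]; ring
      calc π ^ 4 * μt ^ 4 = (π * μt) ^ 4 := by ring
        _ = tE ^ 4 := by rw [← hμt]
        _ = π ^ 4 * (W * (2 * tE ^ 2 - 1)) := by rw [this, h2W]; ring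
    exact mul_left_cancel₀ (pow_ne_zero 4 hπ0) h1
  have h2t1 : ¬ π ∣ 2 * tE ^ 2 - 1 := by
    refine hone (z := π ^ 3 * W * (tE ^ 2 - 1)) ?_
    linear_combination (tE ^ 2 - 1) * h2W
  have hμtn : ¬ π ∣ μt := by
    intro h
    have h4 : π ∣ μt ^ 4 := dvd_pow h (by norm_num)
    rw [hμt4] at h4
    rcases hπ.dvd_or_dvd h4 with h1 | h1
    · exact hW h1
    · exact h2t1 h1
  -- `2 + t = π M`, `π ∤ M`
  obtain ⟨M, hMdef⟩ : ∃ M : 𝓞 E, M = π ^ 3 * W + μt := ⟨_, rfl⟩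
  have h2t : (2 : 𝓞 E) + tE = π * M := by rw [hμt, h2W, hMdef]; ring
  have hM : ¬ π ∣ M := by
    intro h
    apply hμtn
    have : π ∣ M - π ^ 3 * W := dvd_sub h (Dvd.intro (π ^ 2 * W) (by ring))
    rwa [hMdef, add_sub_cancel_left] at this
  -- `π⁸ ‖ ε₀ − 1`
  have hε1 : φ ε₀ - 1 = π ^ 8 * (W ^ 2 + π ^ 4 * ((v : 𝓞 E) ^ 6 * φ c₆)) := by
    rw [← hv] at hc6E
    linear_combination hc6E + (2 + π ^ 4 * W) * h2W
  have h8 : π ^ (2 * 4) ∣ φ ε₀ - 1 := by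
    rw [hε1]; exact Dvd.intro (W ^ 2 + π ^ 4 * ((v : 𝓞 E) ^ 6 * φ c₆)) (by ring)
  have h9 : ¬ π ^ (2 * 4 + 1) ∣ φ ε₀ - 1 := by
    rintro ⟨z, hz⟩
    have h3 : W ^ 2 + π ^ 4 * ((v : 𝓞 E) ^ 6 * φ c₆) = π * z := by
      have h1 : π ^ 8 * (W ^ 2 + π ^ 4 * ((v : 𝓞 E) ^ 6 * φ c₆)) = π ^ 8 * (π * z) := by
        calc π ^ 8 * (W ^ 2 + π ^ 4 * ((v : 𝓞 E) ^ 6 * φ c₆)) = φ ε₀ - 1 := hε1.symm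
          _ = π ^ (2 * 4 + 1) * z := hz
          _ = π ^ 8 * (π * z) := by ring
      exact mul_left_cancel₀ (pow_ne_zero 8 hπ0) h1
    have h5 : π ∣ W ^ 2 := by
      have : π ∣ W ^ 2 + π ^ 4 * ((v : 𝓞 E) ^ 6 * φ c₆) := ⟨z, h3⟩
      have h7 : π ∣ π ^ 4 * ((v : 𝓞 E) ^ 6 * φ c₆) := Dvd.intro (π ^ 3 * ((v : 𝓞 E) ^ 6 * φ c₆)) (by ring)
      have h6 := dvd_sub this h7
      simpa using h6
    exact hW (hπ.dvd_of_dvd_pow h5)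
  -- the dyadic descent at `e = 4`
  have hmain := DyadicDescent.not_exists_sq_sub_mul_sq_fractionRing_of_pow_two_mul_dvd (K := E) (e := 4)
    hπ h2W hW (by norm_num) hresπ hM h8 h9
  have hπM : algebraMap (𝓞 E) E (π * M) = 2 + t := by rw [← h2t, map_add, map_ofNat, htEval]
  refine ⟨Units.mkOfMulEqOne _ _ hεE, fun a c h => hmain ⟨a, c, ?_⟩⟩
  rw [Units.val_mkOfMulEqOne, hcoe] at h
  rw [hπM]
  exact h

end LayerTwo

end Summit.BirchSwinnertonDyer.BirchSwinnertonDyer.Theorems.AddKatoTwo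

end
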